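import Literature.MathematicalPhysics.QuantumFieldTheory.Balaban1983to89.B9Eq319QprimeTowerLipschitzL2TwoBackgrounds
import Literature.MathematicalPhysics.QuantumFieldTheory.Balaban1983to89.B9Eq368RLipschitzTwoBackgrounds

/-!
# `Balaban1983to89.B9Eq319QprimeTowerLipschitzL2TwoBackgroundsChain` — T. Bałaban, *Propagators for lattice gauge theories in a background field*,
# Commun. Math. Phys. **99** (1985) 389–434 [Balaban1985BackgroundPropagators] (3.19) p. 393, (3.11) p. 392, (3.16) p. 393, (3.35)–(3.37) p. 396, p. 403
# («… satisfy the same bounds»), (3.65) p. 403, (3.79)–(3.81) p. 406: **THE TWO-BACKGROUND TOWER LETTER `ρ′_k(U,V)` ∕ `θ_Q(U,V)` ON THE NE9 CHAIN's CARRIER,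
# `ℓ²` CURRENCY, VOLUME-FREE AND LEVEL-FREE** — for two backgrounds `U`, `V` of the finest torus whose level averages `Ū^j`, `V̄^j` are `U1`-valued,
# `ε_j`-small and `δ_j`-close: `√(Σ_y ‖(Q′_k(U)λ − Q′_k(V)λ)(y)‖²) ≤ P·(T − 1)·√((c₀L^{kd})⁻¹)·‖λ‖_{L²(c₀)}` and, under geometric profiles `ε_j ≤ ε⋆r^j`,
# `δ_j ≤ δ⋆r^j`, the weight-`c₁` letter **`‖Q̃′_k(U)λ − Q̃′_k(V)λ‖_{c₁} ≤ 2e^{A}B·δ⋆·√(c₁∕(c₀L^{kd}))·‖λ‖_{c₀}`** (`= 2e^{A}B·δ⋆·‖λ‖` along (3.16)) —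
# file 1's abstract telescoping read at the transporters `R(Ū^j(b))`, `R(V̄^j(b))`; the `hdQ`∕`hQU` letters of this lineage's two-background `k`-level
# `R`-letter `B9Eq325RLipschitzSqrtTower.norm_RofUk_sub_RofUk_le_sqrt`

statement-level skeleton of published theorems with citation tags; proofs where landed; nothing here is a claim about the Yang–Mills mass gap

PDF held: `paper:balaban1985-cmp99-background-propagators` (journal page = PDF page + 388), pp. 392–393, 396, 403, 406 — through the verbatim quotations of
the supplier files (file 1, `B9Eq319QprimeTowerLipschitzL2`, `B9Eq315QTowerLipschitzTwoBackgrounds`, `B9Eq368RLipschitzTwoBackgrounds`).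

CITATION HEADER (lean-in-tree rule 2026-08-18).  Audit cell `pub-balaban`, sub-cell `t4`, NE9 crux team (2): LEAF PROVER 04
(`b2b-balaban-t4-ne9-formalise-leaf-04` gen 77), INTENT-1 (file 2 of 2).  The volume-free, level-free replacement of the fixed-lattice letter
`B9Eq315QTowerLipschitzTwoBackgrounds.norm_QprimeTowerW_sub_QprimeTowerW_le` (`(n+1)K^{n+1}`, `(√c₀)⁻¹`) — first storey of the two-background twin of the
NE9 owner's g85∕g86 diagonal ladder (see file 1's header).

THE PRINT (verbatim, as quoted by the suppliers).  (3.19) p. 393: *«… Q′_k = Q′(Ū^{k−1})⋯Q′(U)»*; (3.16) p. 393: the `k`-th-step normalisation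
(`η = L^{−k}`, unit coarse lattice); p. 403 l. 27–28: *«… extend analytically to the domain (3.37) and satisfy the same bounds»*.

WHAT IS PROVED (sorry-free; proof lane — 0 `def`, no `Prop` placeholder, no inequality of the papers asserted hypothesis-free; [folklore]).
* §2 **`profile_product_le_linear`** — THE PROFILE ARITHMETIC (pure reals): under `ε_j ≤ ε⋆r^j`, `δ_j ≤ δ⋆r^j` (`j < n+1`, `0 ≤ r < 1`) and `Bδ⋆ ≤ 1`:
  `P·(T − 1) ≤ 2e^{A}B·δ⋆`, `P = Π_{j≤n}(1+2M_φM_φ′ε_j)^{d(L−1)}`, `T = Π_{j≤n}(1 + d(L−1)·2M_φM_φ′δ_j·(1+2M_φM_φ′ε_j)^{d(L−1)})`,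
  `A = d(L−1)·2M_φM_φ′ε⋆∕(1−r)`, `B = d(L−1)·2M_φM_φ′·(1+2M_φM_φ′ε⋆)^{d(L−1)}∕(1−r)` — FREE OF THE NUMBER OF LEVELS;
  **`sqrt_sum_norm_sq_QprimeTowerW_sub_QprimeTowerW_le`** — for two backgrounds `U`, `V` of `T_{L^{n+1}m}` with level averages `Ū^j(b), V̄^j(b) ∈ U1`,
  `‖Ū^j(b) − 1‖, ‖V̄^j(b) − 1‖ ≤ ε_j`, `‖Ū^j(b) − V̄^j(b)‖ ≤ δ_j` (DISPLAYED):
  `√(Σ_y ‖(Q′_{n+1}(U)λ − Q′_{n+1}(V)λ)(y)‖²) ≤ P·(T − 1)·√((c₀(L^{n+1})^d)⁻¹)·‖λ‖_{L²(c₀)}` — transporters `2M_φM_φ′ε_j`-close to the identity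
  (`norm_adTransportW_sub_le`) and `2M_φM_φ′δ_j`-close to each other (`norm_adTransportW_sub_adTransportW_le`), file 1 §1.
* §3 the weight-`c₁` readings of `Q̃′_k := (L²(c₁)-bundling) ∘ Q′_k`: **`norm_QtildeTower_sub_QtildeTower_le`** (`≤ P·(T − 1)·√(c₁∕(c₀(L^{n+1})^d))·‖λ‖`),
  **`norm_QtildeTower_sub_QtildeTower_le_linear`** (`≤ 2e^{A}B·δ⋆·√(c₁∕(c₀(L^{n+1})^d))·‖λ‖`), **`norm_QtildeTower_le`** (ONE background:
  `‖Q̃′_{n+1}(U)λ‖_{c₁} ≤ P·√(c₁∕(c₀(L^{n+1})^d))·‖λ‖`) — `√(c₁∕(c₀L^{kd})) = (ηL^k)⁻¹ = 1` along (3.16): NO volume, NO `(√c₀)⁻¹`, NO number of levels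
  beyond the displayed products.
MODEL ∕ DECLARED READINGS.  (M1) as `B9Eq319QprimeTowerLipschitzL2` §3–§4 ∕ `B9Eq315QTowerLipschitzTwoBackgrounds` §3: the level averages `UlevOf` of
two backgrounds of the finest torus; `𝔸` a complete normed `ℂ`-algebra with `‖1‖ = 1`, fibre `W ≃ 𝔸` along `φ` with `M_φ`, `M_φ′`.  (M2) the smallness
`ε_j`, unit-boundedness and closeness `δ_j` of the level averages are DISPLAYED hypotheses (print's running small-field axioms (3.35) ∕ [I] (1.11)–(1.14));
NEITHER [Balaban1985Averaging] Prop. 2 (ne9-leaf-03's `B7Eq43AveragedSmallnessLevelFree` supplies the one-background profile) NOR the Lipschitz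
continuity of the averaging map `U ↦ Ū` (the profile `δ_j` from `‖U(b) − V(b)‖`) is proved here.  (M3) `√((c₀L^{kd})⁻¹) = 1` along (3.11)∕(3.16) —
NOT a volume.
HONEST SCOPE.  [folklore] reading of file 1 at landed transporter letters + real arithmetic; the `θ_Q(U,V)` letter of ONE route sub-step (S3 at `k`
levels, two backgrounds); «NE9 ⇐ the named binders»; NE9 NOT PRINTED ∕ NOT PROVED; NOT summit progress (cell pub-balaban: row NE9 WALLED ON A MODEL;
spine PROVED 0∕9; rung (B)+1 on a finite T⁴ — NOT infinite volume, NOT mass gap, NOT BetaPertH, NOT Clay; HONEST DEPENDENCY: continuum YM on T⁴ ⇐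
BetaPertH ∧ nine spine estimates (0/9 proved); BetaPertH ⇐ (D1) ∧ (D4) ∧ CAP+tail; G-an2-4 gates asym, D1 and NE2/3/4).  NEW file importing file 1 +
`B9Eq368RLipschitzTwoBackgrounds` (for `norm_adTransportW_sub_adTransportW_le` BY NAME); nothing modified.  Net new unproved facts: 0.
-/

noncomputable section

open scoped BigOperators

namespace Literature.MathematicalPhysics.QuantumFieldTheory.Balaban1983to89.B9Eq319QprimeTowerLipschitzL2TwoBackgroundsChain

open B4Sect5Torus (TSite)
open B9SectCLatticeCarrier (Bond)
open B7Prop1Explicit (U1)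
open B9Eq311L2Pairing (WL2)
open B11Eq103H1Complex (SiteL2K)
open B9Eq315QTower (towerP UlevOf QprimeTower)
open B9Eq326OperatorTower (QprimeTowerW)
open B9Eq310HessianOperator (adTransportW)
open B9Eq384RemainderLetters (norm_adTransportW_sub_le)
open B9Eq368RLipschitzTwoBackgrounds (norm_adTransportW_sub_adTransportW_le)
open B9Eq319QprimeTowerLipschitzL2TwoBackgrounds (sqrt_sum_norm_sq_QprimeTower_le sqrt_sum_norm_sq_QprimeTower_sub_QprimeTower_le)

variable {d : ℕ} (L : ℕ) [NeZero L]

/-! ## §2 The reading on the chain's carrier `QprimeTowerW` for two backgrounds `U`, `V` -/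

section Readings

/-- `Π_{j<n}(1 + t_j) ≤ exp(Σ_{j<n} t_j)` for `t_j ≥ 0`. [folklore] -/
private theorem prod_one_add_le_exp_sum (t : ℕ → ℝ) (ht : ∀ j, 0 ≤ t j) (n : ℕ) :
    ∏ j ∈ Finset.range n, (1 + t j) ≤ Real.exp (∑ j ∈ Finset.range n, t j) := by
  rw [Real.exp_sum]
  exact Finset.prod_le_prod (fun j _ => by linarith [ht j]) fun j _ => by linarith [Real.add_one_le_exp (t j)]

/-- `Σ_{j<n} s·r^j ≤ s∕(1−r)` for `0 ≤ r < 1`, `0 ≤ s`. [folklore] -/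
private theorem sum_geometric_le (s r : ℝ) (hs : 0 ≤ s) (hr0 : 0 ≤ r) (hr1 : r < 1) (n : ℕ) :
    ∑ j ∈ Finset.range n, s * r ^ j ≤ s / (1 - r) := by
  rw [← Finset.mul_sum, div_eq_mul_one_div]
  refine mul_le_mul_of_nonneg_left ?_ hs
  have h := geom_sum_Ico_le_of_lt_one (m := 0) (n := n) hr0 hr1
  rw [pow_zero] at h
  rwa [Finset.range_eq_Ico]

/-- `e^y − 1 ≤ 2y` for `0 ≤ y ≤ 1`. [folklore] -/
private theorem exp_sub_one_le_two_mul {y : ℝ} (hy0 : 0 ≤ y) (hy1 : y ≤ 1) : Real.exp y - 1 ≤ 2 * y := by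
  have h := Real.abs_exp_sub_one_sub_id_le (x := y) (by rw [abs_of_nonneg hy0]; exact hy1)
  have h1 : Real.exp y - 1 - y ≤ y ^ 2 := (le_abs_self _).trans h
  have h2 : y ^ 2 ≤ y := by rw [pow_two]; exact mul_le_of_le_one_left hy0 hy1
  linarith

omit [NeZero L] in
/-- `(√a)^n = √(a^n)` for `a ≥ 0`. [folklore] -/
private theorem sqrt_pow_eq {a : ℝ} (ha : 0 ≤ a) : ∀ n : ℕ, (Real.sqrt a) ^ n = Real.sqrt (a ^ n)
  | 0 => by simp
  | n + 1 => by rw [pow_succ, sqrt_pow_eq ha n, pow_succ, Real.sqrt_mul (pow_nonneg ha n)]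

omit [NeZero L] in
/-- **THE PROFILE ARITHMETIC**: under `ε_j ≤ ε⋆r^j`, `δ_j ≤ δ⋆r^j` (`j < n+1`, `0 ≤ r < 1`) and the window `Bδ⋆ ≤ 1`:
`P·(T − 1) ≤ 2e^{A}B·δ⋆` with `P = Π_{j≤n}(1+2M_φM_φ′ε_j)^{d(L−1)}`, `T = Π_{j≤n}(1 + d(L−1)·2M_φM_φ′δ_j·(1+2M_φM_φ′ε_j)^{d(L−1)})`,
`A = d(L−1)·2M_φM_φ′ε⋆∕(1−r)`, `B = d(L−1)·2M_φM_φ′(1+2M_φM_φ′ε⋆)^{d(L−1)}∕(1−r)` (`Π(1+t_j) ≤ e^{Σt_j}`, geometric sums, `e^y − 1 ≤ 2y` on `[0,1]`) —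
FREE OF THE NUMBER OF LEVELS. [folklore] [cite: Balaban1985BackgroundPropagators, (3.35)–(3.37) p.396] -/
theorem profile_product_le_linear {Mφ Mφ' r εs δs : ℝ} (hMφ : 0 ≤ Mφ) (hMφ' : 0 ≤ Mφ') (hr0 : 0 ≤ r) (hr1 : r < 1) (hεs : 0 ≤ εs)
    (hδs : 0 ≤ δs) (εU δUV : ℕ → ℝ) (hεU : ∀ j, 0 ≤ εU j) (hδUV : ∀ j, 0 ≤ δUV j) (n : ℕ)
    (hεg : ∀ j < n + 1, εU j ≤ εs * r ^ j) (hδg : ∀ j < n + 1, δUV j ≤ δs * r ^ j)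
    (hwin : ((d * (L - 1) : ℕ) * (2 * Mφ * Mφ') * (1 + 2 * Mφ * Mφ' * εs) ^ (d * (L - 1)) / (1 - r)) * δs ≤ 1) :
    (∏ j ∈ Finset.range (n + 1), (1 + 2 * Mφ * Mφ' * εU j) ^ (d * (L - 1))) *
        ((∏ j ∈ Finset.range (n + 1), (1 + (d * (L - 1) : ℕ) * (2 * Mφ * Mφ' * δUV j) * (1 + 2 * Mφ * Mφ' * εU j) ^ (d * (L - 1)))) - 1) ≤
      2 * Real.exp ((d * (L - 1) : ℕ) * (2 * Mφ * Mφ' * εs / (1 - r))) *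
        (((d * (L - 1) : ℕ) * (2 * Mφ * Mφ') * (1 + 2 * Mφ * Mφ' * εs) ^ (d * (L - 1)) / (1 - r)) * δs) := by
  set K : ℝ := (1 + 2 * Mφ * Mφ' * εs) ^ (d * (L - 1)) with hK
  have h1r : 0 < 1 - r := by linarith
  have ht : ∀ j, (0 : ℝ) ≤ 2 * Mφ * Mφ' * εU j := fun j => by have := hεU j; positivity
  have ht' : ∀ j, (0 : ℝ) ≤ 2 * Mφ * Mφ' * εs * r ^ j := fun j => by positivity
  have htt' : ∀ j ∈ Finset.range (n + 1), 2 * Mφ * Mφ' * εU j ≤ 2 * Mφ * Mφ' * εs * r ^ j := fun j hj => by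
    have h := mul_le_mul_of_nonneg_left (hεg j (Finset.mem_range.1 hj)) (by positivity : (0 : ℝ) ≤ 2 * Mφ * Mφ')
    linarith [h]
  -- `P ≤ e^{A}`
  have hP : ∏ j ∈ Finset.range (n + 1), (1 + 2 * Mφ * Mφ' * εU j) ^ (d * (L - 1)) ≤
      Real.exp ((d * (L - 1) : ℕ) * (2 * Mφ * Mφ' * εs / (1 - r))) := by
    rw [Finset.prod_pow, Real.exp_nat_mul]
    have h1 : ∏ j ∈ Finset.range (n + 1), (1 + 2 * Mφ * Mφ' * εU j) ≤ Real.exp (2 * Mφ * Mφ' * εs / (1 - r)) :=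
      calc ∏ j ∈ Finset.range (n + 1), (1 + 2 * Mφ * Mφ' * εU j)
          ≤ ∏ j ∈ Finset.range (n + 1), (1 + 2 * Mφ * Mφ' * εs * r ^ j) :=
            Finset.prod_le_prod (fun j _ => by linarith [ht j]) fun j hj => by linarith [htt' j hj]
        _ ≤ Real.exp (∑ j ∈ Finset.range (n + 1), 2 * Mφ * Mφ' * εs * r ^ j) := prod_one_add_le_exp_sum _ ht' (n + 1)
        _ ≤ Real.exp (2 * Mφ * Mφ' * εs / (1 - r)) :=
            Real.exp_le_exp.2 (sum_geometric_le (2 * Mφ * Mφ' * εs) r (by positivity) hr0 hr1 (n + 1))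
    exact pow_le_pow_left₀ (Finset.prod_nonneg fun j _ => by linarith [ht j]) h1 _
  -- `T − 1 ≤ e^{Bδ⋆} − 1 ≤ 2Bδ⋆`: every level factor `(1+2M_φM_φ′ε_j)^{d(L−1)} ≤ K` since `ε_j ≤ ε⋆r^j ≤ ε⋆`
  have hs : ∀ j, (0 : ℝ) ≤ (d * (L - 1) : ℕ) * (2 * Mφ * Mφ' * δUV j) * (1 + 2 * Mφ * Mφ' * εU j) ^ (d * (L - 1)) := fun j => by
    have := hδUV j; have := ht j; positivity
  have hs' : ∀ j, (0 : ℝ) ≤ (d * (L - 1) : ℕ) * (2 * Mφ * Mφ') * K * δs * r ^ j := fun j => by positivity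
  have hss' : ∀ j ∈ Finset.range (n + 1), (d * (L - 1) : ℕ) * (2 * Mφ * Mφ' * δUV j) * (1 + 2 * Mφ * Mφ' * εU j) ^ (d * (L - 1)) ≤
      (d * (L - 1) : ℕ) * (2 * Mφ * Mφ') * K * δs * r ^ j := fun j hj => by
    have hj' := Finset.mem_range.1 hj
    have hεj : εU j ≤ εs := (hεg j hj').trans (mul_le_of_le_one_right hεs (pow_le_one₀ hr0 hr1.le))
    have hpow : (1 + 2 * Mφ * Mφ' * εU j) ^ (d * (L - 1)) ≤ K := by
      rw [hK]; exact pow_le_pow_left₀ (by linarith [ht j]) (by nlinarith [hεj, mul_nonneg hMφ hMφ']) _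
    calc (d * (L - 1) : ℕ) * (2 * Mφ * Mφ' * δUV j) * (1 + 2 * Mφ * Mφ' * εU j) ^ (d * (L - 1))
        ≤ (d * (L - 1) : ℕ) * (2 * Mφ * Mφ' * (δs * r ^ j)) * K := by
          have h0 : 0 ≤ (1 + 2 * Mφ * Mφ' * εU j) ^ (d * (L - 1)) := pow_nonneg (by linarith [ht j]) _
          have hδj := hδg j hj'
          gcongr
      _ = (d * (L - 1) : ℕ) * (2 * Mφ * Mφ') * K * δs * r ^ j := by ring
  have hB0 : 0 ≤ ((d * (L - 1) : ℕ) * (2 * Mφ * Mφ') * K / (1 - r)) * δs := by positivity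
  have hT : (∏ j ∈ Finset.range (n + 1), (1 + (d * (L - 1) : ℕ) * (2 * Mφ * Mφ' * δUV j) * (1 + 2 * Mφ * Mφ' * εU j) ^ (d * (L - 1)))) - 1 ≤
      2 * (((d * (L - 1) : ℕ) * (2 * Mφ * Mφ') * K / (1 - r)) * δs) := by
    refine le_trans (sub_le_sub_right ?_ 1) (exp_sub_one_le_two_mul hB0 hwin)
    calc ∏ j ∈ Finset.range (n + 1), (1 + (d * (L - 1) : ℕ) * (2 * Mφ * Mφ' * δUV j) * (1 + 2 * Mφ * Mφ' * εU j) ^ (d * (L - 1)))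
        ≤ ∏ j ∈ Finset.range (n + 1), (1 + (d * (L - 1) : ℕ) * (2 * Mφ * Mφ') * K * δs * r ^ j) :=
          Finset.prod_le_prod (fun j _ => by linarith [hs j]) fun j hj => by linarith [hss' j hj]
      _ ≤ Real.exp (∑ j ∈ Finset.range (n + 1), (d * (L - 1) : ℕ) * (2 * Mφ * Mφ') * K * δs * r ^ j) := prod_one_add_le_exp_sum _ hs' (n + 1)
      _ ≤ Real.exp (((d * (L - 1) : ℕ) * (2 * Mφ * Mφ') * K * δs) / (1 - r)) :=
          Real.exp_le_exp.2 (sum_geometric_le _ r (by positivity) hr0 hr1 (n + 1))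
      _ = Real.exp (((d * (L - 1) : ℕ) * (2 * Mφ * Mφ') * K / (1 - r)) * δs) := by congr 1; ring
  have hT0 : 0 ≤ (∏ j ∈ Finset.range (n + 1), (1 + (d * (L - 1) : ℕ) * (2 * Mφ * Mφ' * δUV j) * (1 + 2 * Mφ * Mφ' * εU j) ^ (d * (L - 1)))) - 1 :=
    sub_nonneg.2 (Finset.one_le_prod (s := Finset.range (n + 1)) fun j _ => by linarith [hs j])
  calc _ ≤ Real.exp ((d * (L - 1) : ℕ) * (2 * Mφ * Mφ' * εs / (1 - r))) * (2 * (((d * (L - 1) : ℕ) * (2 * Mφ * Mφ') * K / (1 - r)) * δs)) :=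
        mul_le_mul hP hT hT0 (Real.exp_pos _).le
    _ = _ := by ring

variable {𝔸 : Type*} [NormedRing 𝔸] [NormedAlgebra ℂ 𝔸] [CompleteSpace 𝔸] [NormOneClass 𝔸]
  (m : Fin d → ℕ) [∀ i, NeZero (m i)] (n : ℕ)
  {W : Type*} [NormedAddCommGroup W] [InnerProductSpace ℂ W] (φ : W ≃ₗ[ℂ] 𝔸) {Mφ Mφ' : ℝ} (hMφ : 0 ≤ Mφ) (hMφ' : 0 ≤ Mφ')
  (hφ : ∀ w, ‖φ w‖ ≤ Mφ * ‖w‖) (hφ' : ∀ X, ‖φ.symm X‖ ≤ Mφ' * ‖X‖) {c₀ : ℝ} [Fact (0 < c₀)]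
  (U V : Bond d (towerP L m (n + 1)) → 𝔸ˣ) (εU δUV : ℕ → ℝ) (hεU : ∀ j, 0 ≤ εU j) (hδUV : ∀ j, 0 ≤ δUV j)
  (hUε : ∀ (j : ℕ) (b : Bond d (towerP L m (j + 1))), ‖(UlevOf L m (n + 1) U j b : 𝔸) - 1‖ ≤ εU j)
  (hVε : ∀ (j : ℕ) (b : Bond d (towerP L m (j + 1))), ‖(UlevOf L m (n + 1) V j b : 𝔸) - 1‖ ≤ εU j)
  (hUb : ∀ (j : ℕ) (b : Bond d (towerP L m (j + 1))), UlevOf L m (n + 1) U j b ∈ U1 𝔸)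
  (hVb : ∀ (j : ℕ) (b : Bond d (towerP L m (j + 1))), UlevOf L m (n + 1) V j b ∈ U1 𝔸)
  (hUV : ∀ (j : ℕ) (b : Bond d (towerP L m (j + 1))), ‖(UlevOf L m (n + 1) U j b : 𝔸) - (UlevOf L m (n + 1) V j b : 𝔸)‖ ≤ δUV j)

include hφ hφ' hMφ hMφ' hεU hδUV hUε hVε hUb hVb hUV in
/-- **THE TWO-BACKGROUND TOWER LETTER `ρ′_k(U,V)` ON THE CHAIN's CARRIER, `ℓ²` CURRENCY, VOLUME-FREE**: for two backgrounds `U`, `V` of `T_{L^{n+1}m}`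
whose level averages are `U1`-valued, `ε_j`-small and `δ_j`-close,
`√(Σ_y ‖(Q′_{n+1}(U)λ − Q′_{n+1}(V)λ)(y)‖²) ≤ Π_{j≤n}(1+2M_φM_φ′ε_j)^{d(L−1)}·(Π_{j≤n}(1 + d(L−1)·2M_φM_φ′δ_j·(1+2M_φM_φ′ε_j)^{d(L−1)}) − 1)·√((c₀(L^{n+1})^d)⁻¹)·‖λ‖_{L²(c₀)}`
— the transporters `R(Ū^j(b))`, `R(V̄^j(b))` are `2M_φM_φ′ε_j`-close to the identity (`norm_adTransportW_sub_le`) and `2M_φM_φ′δ_j`-close to each other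
(`norm_adTransportW_sub_adTransportW_le`); `√((c₀L^{kd})⁻¹) = 1` along (3.11)∕(3.16). The sup-norm, fixed-lattice twin is
`B9Eq315QTowerLipschitzTwoBackgrounds.norm_QprimeTowerW_sub_QprimeTowerW_le` (`(n+1)K^{n+1}`, `(√c₀)⁻¹`).
[cite: Balaban1985BackgroundPropagators, (3.19) p.393, (3.11) p.392, (3.35)–(3.37) p.396, (3.65) p.403, (3.79)–(3.81) p.406] -/
theorem sqrt_sum_norm_sq_QprimeTowerW_sub_QprimeTowerW_le (l : SiteL2K ℂ d (towerP L m (n + 1)) c₀ W) :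
    Real.sqrt (∑ y : TSite d m, ‖QprimeTowerW L m n φ U (c₀ := c₀) l y - QprimeTowerW L m n φ V (c₀ := c₀) l y‖ ^ 2) ≤
      (∏ j ∈ Finset.range (n + 1), (1 + 2 * Mφ * Mφ' * εU j) ^ (d * (L - 1))) *
        ((∏ j ∈ Finset.range (n + 1), (1 + (d * (L - 1) : ℕ) * (2 * Mφ * Mφ' * δUV j) * (1 + 2 * Mφ * Mφ' * εU j) ^ (d * (L - 1)))) - 1) *
        (Real.sqrt ((c₀ * ((L : ℝ) ^ (n + 1)) ^ d)⁻¹) * ‖l‖) := by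
  have hc₀ : 0 < c₀ := Fact.out
  have hL0 : (0 : ℝ) < L := by exact_mod_cast Nat.pos_of_ne_zero (NeZero.ne L)
  have hε : ∀ j, 0 ≤ 2 * Mφ * Mφ' * εU j := fun j => by have := hεU j; positivity
  have hδ : ∀ j, 0 ≤ 2 * Mφ * Mφ' * δUV j := fun j => by have := hδUV j; positivity
  have hR : ∀ (j : ℕ) (b : Bond d (towerP L m (j + 1))) (v : W),
      ‖adTransportW φ (UlevOf L m (n + 1) U j) b v - v‖ ≤ 2 * Mφ * Mφ' * εU j * ‖v‖ :=
    fun j b v => norm_adTransportW_sub_le φ hφ hφ' hMφ' _ b (hUb j b) (hUε j b) v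
  have hR' : ∀ (j : ℕ) (b : Bond d (towerP L m (j + 1))) (v : W),
      ‖adTransportW φ (UlevOf L m (n + 1) V j) b v - v‖ ≤ 2 * Mφ * Mφ' * εU j * ‖v‖ :=
    fun j b v => norm_adTransportW_sub_le φ hφ hφ' hMφ' _ b (hVb j b) (hVε j b) v
  have hRR' : ∀ (j : ℕ) (b : Bond d (towerP L m (j + 1))) (v : W),
      ‖adTransportW φ (UlevOf L m (n + 1) U j) b v - adTransportW φ (UlevOf L m (n + 1) V j) b v‖ ≤ 2 * Mφ * Mφ' * δUV j * ‖v‖ :=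
    fun j b v => norm_adTransportW_sub_adTransportW_le L (towerP L m j) φ hφ hφ' hMφ' _ _ b (hUb j b) (hVb j b) (hUV j b) v
  -- the underlying fine function and its `ℓ²` mass: `Σ_x ‖λ x‖² = ‖λ‖² ∕ c₀`
  set lf : TSite d (towerP L m (n + 1)) → W := WL2.linearEquiv ℂ ℂ (fun _ : TSite d (towerP L m (n + 1)) => c₀) l with hlf
  have hmass : Real.sqrt (∑ x, ‖lf x‖ ^ 2) = (Real.sqrt c₀)⁻¹ * ‖l‖ := by
    have hn : ‖l‖ ^ 2 = ∑ x, c₀ * ‖WL2.equiv ℂ (fun _ : TSite d (towerP L m (n + 1)) => c₀) W l x‖ ^ 2 :=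
      WL2.norm_sq (𝕜 := ℂ) (w := fun _ : TSite d (towerP L m (n + 1)) => c₀) (V := W) l
    have hsum : ∑ x, ‖lf x‖ ^ 2 = c₀⁻¹ * ‖l‖ ^ 2 := by
      rw [hn, Finset.mul_sum]
      refine Finset.sum_congr rfl fun x _ => ?_
      rw [hlf]; field_simp; rfl
    rw [hsum, Real.sqrt_mul (inv_nonneg.2 hc₀.le), Real.sqrt_inv, Real.sqrt_sq (norm_nonneg _)]
  have htel := sqrt_sum_norm_sq_QprimeTower_sub_QprimeTower_le L m (fun j => adTransportW φ (UlevOf L m (n + 1) U j))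
    (fun j => adTransportW φ (UlevOf L m (n + 1) V j)) (fun j => 2 * Mφ * Mφ' * εU j) (fun j => 2 * Mφ * Mφ' * δUV j) hε hδ hR hR' hRR' (n + 1) lf
  -- identify the two sides with `QprimeTowerW`
  have hU' : ∀ y, QprimeTowerW L m n φ U (c₀ := c₀) l y = QprimeTower L m (fun j => adTransportW φ (UlevOf L m (n + 1) U j)) (n + 1) lf y :=
    fun y => rfl
  have hV' : ∀ y, QprimeTowerW L m n φ V (c₀ := c₀) l y = QprimeTower L m (fun j => adTransportW φ (UlevOf L m (n + 1) V j)) (n + 1) lf y :=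
    fun y => rfl
  simp only [hU', hV']
  refine htel.trans (le_of_eq ?_)
  have hprod : ∏ j ∈ Finset.range (n + 1), (1 + ((1 + 2 * Mφ * Mφ' * εU j) ^ (d * (L - 1)) - 1)) =
      ∏ j ∈ Finset.range (n + 1), (1 + 2 * Mφ * Mφ' * εU j) ^ (d * (L - 1)) :=
    Finset.prod_congr rfl fun j _ => by ring
  have hρ : (Real.sqrt (((L : ℝ) ^ d)⁻¹)) ^ (n + 1) * (Real.sqrt c₀)⁻¹ = Real.sqrt ((c₀ * ((L : ℝ) ^ (n + 1)) ^ d)⁻¹) := by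
    rw [sqrt_pow_eq (by positivity : (0:ℝ) ≤ ((L : ℝ) ^ d)⁻¹) (n + 1), ← Real.sqrt_inv, ← Real.sqrt_mul (by positivity), mul_inv,
      mul_comm (c₀⁻¹)]
    congr 1
    rw [inv_pow, ← pow_mul, ← pow_mul, Nat.mul_comm d (n + 1)]
  rw [hprod, hmass, ← mul_assoc ((Real.sqrt (((L : ℝ) ^ d)⁻¹)) ^ (n + 1)), hρ]

end Readings

/-! ## §3 The weight-`c₁` readings: the two-background `θ_Q(U,V)` letter and the one-background `M_Q(U)` letter of `Q̃′_k := (L²(c₁)-bundling) ∘ Q′_k` -/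

section Qtilde

variable {𝔸 : Type*} [NormedRing 𝔸] [NormedAlgebra ℂ 𝔸] [CompleteSpace 𝔸] [NormOneClass 𝔸]
  (m : Fin d → ℕ) [∀ i, NeZero (m i)] (n : ℕ)
  {W : Type*} [NormedAddCommGroup W] [InnerProductSpace ℂ W] (φ : W ≃ₗ[ℂ] 𝔸) {Mφ Mφ' : ℝ} (hMφ : 0 ≤ Mφ) (hMφ' : 0 ≤ Mφ')
  (hφ : ∀ w, ‖φ w‖ ≤ Mφ * ‖w‖) (hφ' : ∀ X, ‖φ.symm X‖ ≤ Mφ' * ‖X‖) {c₀ : ℝ} [Fact (0 < c₀)] (c₁ : ℝ) [Fact (0 < c₁)]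
  (U V : Bond d (towerP L m (n + 1)) → 𝔸ˣ) (εU δUV : ℕ → ℝ) (hεU : ∀ j, 0 ≤ εU j) (hδUV : ∀ j, 0 ≤ δUV j)
  (hUε : ∀ (j : ℕ) (b : Bond d (towerP L m (j + 1))), ‖(UlevOf L m (n + 1) U j b : 𝔸) - 1‖ ≤ εU j)
  (hVε : ∀ (j : ℕ) (b : Bond d (towerP L m (j + 1))), ‖(UlevOf L m (n + 1) V j b : 𝔸) - 1‖ ≤ εU j)
  (hUb : ∀ (j : ℕ) (b : Bond d (towerP L m (j + 1))), UlevOf L m (n + 1) U j b ∈ U1 𝔸)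
  (hVb : ∀ (j : ℕ) (b : Bond d (towerP L m (j + 1))), UlevOf L m (n + 1) V j b ∈ U1 𝔸)
  (hUV : ∀ (j : ℕ) (b : Bond d (towerP L m (j + 1))), ‖(UlevOf L m (n + 1) U j b : 𝔸) - (UlevOf L m (n + 1) V j b : 𝔸)‖ ≤ δUV j)

omit [NeZero L] [∀ i, NeZero (m i)] in
/-- the weight-`c₁` norm of a bundled coarse function is `√c₁·√Σ_y‖f y‖²`. [cite: Balaban1985BackgroundPropagators, (3.11) p.392] -/
private theorem norm_bundle_eq (f : TSite d m → W) :
    ‖(WL2.linearEquiv ℂ ℂ (fun _ : TSite d m => c₁)).symm f‖ = Real.sqrt c₁ * Real.sqrt (∑ y, ‖f y‖ ^ 2) := by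
  have hc₁ : 0 < c₁ := Fact.out
  have h := WL2.norm_sq (𝕜 := ℂ) (w := fun _ : TSite d m => c₁) (V := W) ((WL2.linearEquiv ℂ ℂ (fun _ : TSite d m => c₁)).symm f)
  have h' : ‖(WL2.linearEquiv ℂ ℂ (fun _ : TSite d m => c₁)).symm f‖ ^ 2 = c₁ * ∑ y, ‖f y‖ ^ 2 := by
    rw [h, Finset.mul_sum]; rfl
  rw [← Real.sqrt_mul hc₁.le, ← h', Real.sqrt_sq (norm_nonneg _)]

omit [NeZero L] [∀ i, NeZero (m i)] [Fact (0 < c₀)] in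
/-- `√c₁·√((c₀(L^{n+1})^d)⁻¹) = √(c₁∕(c₀(L^{n+1})^d))`. [folklore] -/
private theorem sqrt_c₁_mul_sqrt_inv :
    Real.sqrt c₁ * Real.sqrt ((c₀ * ((L : ℝ) ^ (n + 1)) ^ d)⁻¹) = Real.sqrt (c₁ / (c₀ * ((L : ℝ) ^ (n + 1)) ^ d)) := by
  have hc₁ : 0 < c₁ := Fact.out
  rw [← Real.sqrt_mul hc₁.le, div_eq_mul_inv]

include hφ hφ' hMφ hMφ' hεU hδUV hUε hVε hUb hVb hUV in
/-- **THE TWO-BACKGROUND LETTER `θ_Q(U,V)` OF THE k-LEVEL `Q̃′_k` IN THE WEIGHT-`c₁` CURRENCY** (the `hdQ` shape of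
`B9Eq325RLipschitzSqrtTower.norm_RofUk_sub_RofUk_le_sqrt`): `‖Q̃′_{n+1}(U)λ − Q̃′_{n+1}(V)λ‖_{c₁} ≤ P·(T − 1)·√(c₁∕(c₀(L^{n+1})^d))·‖λ‖_{c₀}` with §2's
`P`, `T` — `√(c₁∕(c₀L^{kd})) = (ηL^k)⁻¹ = 1` along (3.16): NO volume, NO `(√c₀)⁻¹`. [cite: Balaban1985BackgroundPropagators, (3.19) p.393, (3.11) p.392, (3.65) p.403, (3.79)–(3.81) p.406] -/
theorem norm_QtildeTower_sub_QtildeTower_le (l : SiteL2K ℂ d (towerP L m (n + 1)) c₀ W) :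
    ‖((WL2.linearEquiv ℂ ℂ (fun _ : TSite d m => c₁)).symm.toLinearMap ∘ₗ QprimeTowerW L m n φ U (c₀ := c₀)) l -
        ((WL2.linearEquiv ℂ ℂ (fun _ : TSite d m => c₁)).symm.toLinearMap ∘ₗ QprimeTowerW L m n φ V (c₀ := c₀)) l‖ ≤
      (∏ j ∈ Finset.range (n + 1), (1 + 2 * Mφ * Mφ' * εU j) ^ (d * (L - 1))) *
        ((∏ j ∈ Finset.range (n + 1), (1 + (d * (L - 1) : ℕ) * (2 * Mφ * Mφ' * δUV j) * (1 + 2 * Mφ * Mφ' * εU j) ^ (d * (L - 1)))) - 1) *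
        Real.sqrt (c₁ / (c₀ * ((L : ℝ) ^ (n + 1)) ^ d)) * ‖l‖ := by
  simp only [LinearMap.comp_apply, LinearEquiv.coe_toLinearMap]
  rw [← map_sub, norm_bundle_eq]
  have h := sqrt_sum_norm_sq_QprimeTowerW_sub_QprimeTowerW_le L m n φ hMφ hMφ' hφ hφ' (c₀ := c₀) U V εU δUV hεU hδUV hUε hVε hUb hVb hUV l
  have h' : Real.sqrt (∑ y, ‖(QprimeTowerW L m n φ U (c₀ := c₀) l - QprimeTowerW L m n φ V (c₀ := c₀) l) y‖ ^ 2) ≤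
      (∏ j ∈ Finset.range (n + 1), (1 + 2 * Mφ * Mφ' * εU j) ^ (d * (L - 1))) *
        ((∏ j ∈ Finset.range (n + 1), (1 + (d * (L - 1) : ℕ) * (2 * Mφ * Mφ' * δUV j) * (1 + 2 * Mφ * Mφ' * εU j) ^ (d * (L - 1)))) - 1) *
        (Real.sqrt ((c₀ * ((L : ℝ) ^ (n + 1)) ^ d)⁻¹) * ‖l‖) := by simpa only [Pi.sub_apply] using h
  calc _ ≤ Real.sqrt c₁ * ((∏ j ∈ Finset.range (n + 1), (1 + 2 * Mφ * Mφ' * εU j) ^ (d * (L - 1))) *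
        ((∏ j ∈ Finset.range (n + 1), (1 + (d * (L - 1) : ℕ) * (2 * Mφ * Mφ' * δUV j) * (1 + 2 * Mφ * Mφ' * εU j) ^ (d * (L - 1)))) - 1) *
        (Real.sqrt ((c₀ * ((L : ℝ) ^ (n + 1)) ^ d)⁻¹) * ‖l‖)) := mul_le_mul_of_nonneg_left h' (Real.sqrt_nonneg _)
    _ = (∏ j ∈ Finset.range (n + 1), (1 + 2 * Mφ * Mφ' * εU j) ^ (d * (L - 1))) *
        ((∏ j ∈ Finset.range (n + 1), (1 + (d * (L - 1) : ℕ) * (2 * Mφ * Mφ' * δUV j) * (1 + 2 * Mφ * Mφ' * εU j) ^ (d * (L - 1)))) - 1) *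
        (Real.sqrt c₁ * Real.sqrt ((c₀ * ((L : ℝ) ^ (n + 1)) ^ d)⁻¹)) * ‖l‖ := by ring
    _ = _ := by rw [sqrt_c₁_mul_sqrt_inv]

include hφ hφ' hMφ hMφ' hεU hδUV hUε hVε hUb hVb hUV in
/-- **… `δ⋆`-LINEAR UNDER GEOMETRIC PROFILES** (`ε_j ≤ ε⋆r^j`, `δ_j ≤ δ⋆r^j`, `Bδ⋆ ≤ 1`):
`‖Q̃′_{n+1}(U)λ − Q̃′_{n+1}(V)λ‖_{c₁} ≤ 2e^{A}B·δ⋆·√(c₁∕(c₀(L^{n+1})^d))·‖λ‖_{c₀}` — FREE OF THE NUMBER OF LEVELS AND OF EVERY VOLUME.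
[cite: Balaban1985BackgroundPropagators, (3.19) p.393, (3.11) p.392, (3.35)–(3.37) p.396, (3.65) p.403] -/
theorem norm_QtildeTower_sub_QtildeTower_le_linear {r εs δs : ℝ} (hr0 : 0 ≤ r) (hr1 : r < 1) (hεs : 0 ≤ εs) (hδs : 0 ≤ δs)
    (hεg : ∀ j < n + 1, εU j ≤ εs * r ^ j) (hδg : ∀ j < n + 1, δUV j ≤ δs * r ^ j)
    (hwin : ((d * (L - 1) : ℕ) * (2 * Mφ * Mφ') * (1 + 2 * Mφ * Mφ' * εs) ^ (d * (L - 1)) / (1 - r)) * δs ≤ 1)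
    (l : SiteL2K ℂ d (towerP L m (n + 1)) c₀ W) :
    ‖((WL2.linearEquiv ℂ ℂ (fun _ : TSite d m => c₁)).symm.toLinearMap ∘ₗ QprimeTowerW L m n φ U (c₀ := c₀)) l -
        ((WL2.linearEquiv ℂ ℂ (fun _ : TSite d m => c₁)).symm.toLinearMap ∘ₗ QprimeTowerW L m n φ V (c₀ := c₀)) l‖ ≤
      2 * Real.exp ((d * (L - 1) : ℕ) * (2 * Mφ * Mφ' * εs / (1 - r))) *
        ((d * (L - 1) : ℕ) * (2 * Mφ * Mφ') * (1 + 2 * Mφ * Mφ' * εs) ^ (d * (L - 1)) / (1 - r)) * δs *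
        Real.sqrt (c₁ / (c₀ * ((L : ℝ) ^ (n + 1)) ^ d)) * ‖l‖ := by
  have base := norm_QtildeTower_sub_QtildeTower_le L m n φ hMφ hMφ' hφ hφ' (c₀ := c₀) c₁ U V εU δUV hεU hδUV hUε hVε hUb hVb hUV l
  have harith := profile_product_le_linear L (d := d) hMφ hMφ' hr0 hr1 hεs hδs εU δUV hεU hδUV n hεg hδg hwin
  have hl0 : 0 ≤ Real.sqrt (c₁ / (c₀ * ((L : ℝ) ^ (n + 1)) ^ d)) * ‖l‖ := by positivity
  calc _ ≤ _ := base
    _ = (∏ j ∈ Finset.range (n + 1), (1 + 2 * Mφ * Mφ' * εU j) ^ (d * (L - 1))) *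
        ((∏ j ∈ Finset.range (n + 1), (1 + (d * (L - 1) : ℕ) * (2 * Mφ * Mφ' * δUV j) * (1 + 2 * Mφ * Mφ' * εU j) ^ (d * (L - 1)))) - 1) *
        (Real.sqrt (c₁ / (c₀ * ((L : ℝ) ^ (n + 1)) ^ d)) * ‖l‖) := by ring
    _ ≤ 2 * Real.exp ((d * (L - 1) : ℕ) * (2 * Mφ * Mφ' * εs / (1 - r))) *
        (((d * (L - 1) : ℕ) * (2 * Mφ * Mφ') * (1 + 2 * Mφ * Mφ' * εs) ^ (d * (L - 1)) / (1 - r)) * δs) *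
        (Real.sqrt (c₁ / (c₀ * ((L : ℝ) ^ (n + 1)) ^ d)) * ‖l‖) := mul_le_mul_of_nonneg_right harith hl0
    _ = _ := by ring

include hφ hφ' hMφ hMφ' hεU hUε hUb in
/-- **THE ONE-BACKGROUND LETTER `M_Q(U)` OF THE k-LEVEL `Q̃′_k` IN THE WEIGHT-`c₁` CURRENCY** (the `hQU` shape of
`B9Eq325RLipschitzSqrtTower.norm_RofUk_sub_RofUk_le_sqrt` at a NON-flat `U`): `‖Q̃′_{n+1}(U)λ‖_{c₁} ≤ Π_{j≤n}(1+2M_φM_φ′ε_j)^{d(L−1)}·√(c₁∕(c₀(L^{n+1})^d))·‖λ‖_{c₀}`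
(§1 `sqrt_sum_norm_sq_QprimeTower_le`). [cite: Balaban1985BackgroundPropagators, (3.19) p.393, (3.11) p.392, p.403] -/
theorem norm_QtildeTower_le (l : SiteL2K ℂ d (towerP L m (n + 1)) c₀ W) :
    ‖((WL2.linearEquiv ℂ ℂ (fun _ : TSite d m => c₁)).symm.toLinearMap ∘ₗ QprimeTowerW L m n φ U (c₀ := c₀)) l‖ ≤
      (∏ j ∈ Finset.range (n + 1), (1 + 2 * Mφ * Mφ' * εU j) ^ (d * (L - 1))) * Real.sqrt (c₁ / (c₀ * ((L : ℝ) ^ (n + 1)) ^ d)) * ‖l‖ := by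
  have hc₀ : 0 < c₀ := Fact.out
  have hL0 : (0 : ℝ) < L := by exact_mod_cast Nat.pos_of_ne_zero (NeZero.ne L)
  have hε : ∀ j, 0 ≤ 2 * Mφ * Mφ' * εU j := fun j => by have := hεU j; positivity
  have hR : ∀ (j : ℕ) (b : Bond d (towerP L m (j + 1))) (v : W),
      ‖adTransportW φ (UlevOf L m (n + 1) U j) b v - v‖ ≤ 2 * Mφ * Mφ' * εU j * ‖v‖ :=
    fun j b v => norm_adTransportW_sub_le φ hφ hφ' hMφ' _ b (hUb j b) (hUε j b) v
  simp only [LinearMap.comp_apply, LinearEquiv.coe_toLinearMap]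
  rw [norm_bundle_eq]
  set lf : TSite d (towerP L m (n + 1)) → W := WL2.linearEquiv ℂ ℂ (fun _ : TSite d (towerP L m (n + 1)) => c₀) l with hlf
  have hmass : Real.sqrt (∑ x, ‖lf x‖ ^ 2) = (Real.sqrt c₀)⁻¹ * ‖l‖ := by
    have hn : ‖l‖ ^ 2 = ∑ x, c₀ * ‖WL2.equiv ℂ (fun _ : TSite d (towerP L m (n + 1)) => c₀) W l x‖ ^ 2 :=
      WL2.norm_sq (𝕜 := ℂ) (w := fun _ : TSite d (towerP L m (n + 1)) => c₀) (V := W) l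
    have hsum : ∑ x, ‖lf x‖ ^ 2 = c₀⁻¹ * ‖l‖ ^ 2 := by
      rw [hn, Finset.mul_sum]
      refine Finset.sum_congr rfl fun x _ => ?_
      rw [hlf]; field_simp; rfl
    rw [hsum, Real.sqrt_mul (inv_nonneg.2 hc₀.le), Real.sqrt_inv, Real.sqrt_sq (norm_nonneg _)]
  have hU' : ∀ y, QprimeTowerW L m n φ U (c₀ := c₀) l y = QprimeTower L m (fun j => adTransportW φ (UlevOf L m (n + 1) U j)) (n + 1) lf y :=
    fun y => rfl
  simp only [hU']
  have h := sqrt_sum_norm_sq_QprimeTower_le L m (fun j => adTransportW φ (UlevOf L m (n + 1) U j)) (fun j => 2 * Mφ * Mφ' * εU j) hε hR (n + 1) lf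
  have hprod : ∏ j ∈ Finset.range (n + 1), (1 + ((1 + 2 * Mφ * Mφ' * εU j) ^ (d * (L - 1)) - 1)) =
      ∏ j ∈ Finset.range (n + 1), (1 + 2 * Mφ * Mφ' * εU j) ^ (d * (L - 1)) :=
    Finset.prod_congr rfl fun j _ => by ring
  have hρ : (Real.sqrt (((L : ℝ) ^ d)⁻¹)) ^ (n + 1) * (Real.sqrt c₀)⁻¹ = Real.sqrt ((c₀ * ((L : ℝ) ^ (n + 1)) ^ d)⁻¹) := by
    rw [sqrt_pow_eq (by positivity : (0:ℝ) ≤ ((L : ℝ) ^ d)⁻¹) (n + 1), ← Real.sqrt_inv, ← Real.sqrt_mul (by positivity), mul_inv,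
      mul_comm (c₀⁻¹)]
    congr 1
    rw [inv_pow, ← pow_mul, ← pow_mul, Nat.mul_comm d (n + 1)]
  rw [hprod, hmass] at h
  calc Real.sqrt c₁ * Real.sqrt (∑ y, ‖QprimeTower L m (fun j => adTransportW φ (UlevOf L m (n + 1) U j)) (n + 1) lf y‖ ^ 2)
      ≤ Real.sqrt c₁ * ((∏ j ∈ Finset.range (n + 1), (1 + 2 * Mφ * Mφ' * εU j) ^ (d * (L - 1))) *
          ((Real.sqrt (((L : ℝ) ^ d)⁻¹)) ^ (n + 1) * ((Real.sqrt c₀)⁻¹ * ‖l‖))) := mul_le_mul_of_nonneg_left h (Real.sqrt_nonneg _)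
    _ = (∏ j ∈ Finset.range (n + 1), (1 + 2 * Mφ * Mφ' * εU j) ^ (d * (L - 1))) *
          (Real.sqrt c₁ * ((Real.sqrt (((L : ℝ) ^ d)⁻¹)) ^ (n + 1) * (Real.sqrt c₀)⁻¹)) * ‖l‖ := by ring
    _ = _ := by rw [hρ, sqrt_c₁_mul_sqrt_inv]

end Qtilde

end Literature.MathematicalPhysics.QuantumFieldTheory.Balaban1983to89.B9Eq319QprimeTowerLipschitzL2TwoBackgroundsChain

end
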